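import Mathlib
import HarnessLib
import Summits.ResolutionOfSingularities.ResolutionOfSingularities.Theorems.WildQuotientsWildQuotientResolutionJordanFourChartSeams
import Summits.ResolutionOfSingularities.ResolutionOfSingularities.Theorems.WildQuotientsWildQuotientResolutionJordanFourChartTTwisted
import Summits.ResolutionOfSingularities.ResolutionOfSingularities.Theorems.WildQuotientsWildQuotientResolutionJordanFourHalfChartRing
import Summits.ResolutionOfSingularities.ResolutionOfSingularities.Theorems.WildQuotientsWildQuotientResolutionJordanFourTwistedChartAction
import Summits.ResolutionOfSingularities.ResolutionOfSingularities.Theorems.WildQuotientsWildQuotientResolutionJordanFourChartWStable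
import Summits.ResolutionOfSingularities.ResolutionOfSingularities.Theorems.WildQuotientsWildQuotientResolutionBlowupExitBasicOpenSections
import Summits.ResolutionOfSingularities.ResolutionOfSingularities.Theorems.WildQuotientsWildQuotientResolutionJordanFourChartWRing

/-!
# V4U ring brick `H₁` (the `μ₂` piece `W_T = chartW`) — assembled through the seam
(crux stmt-ResolutionOfSingularities-15640 `WildQuotients.WildQuotientResolution`, line `Sketch`;
chain w45c programme V4U, `L/w45c/CHAIN.md` v7.7 §0/§4: `H₁` = the second ring-brick hypothesis of
res-L1-w45c-lead-1's `JordanFour.jordanFour_hasResolution_of_ringBricks` (p512651), LITERALLY;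
[OURS · L1 W4.5c] — assembly of landed decls, NOT a statement of any manuscript; replaces the role
of no printed item. Second-hand assembly by res-L1-w45c-stub-2 (owner of record res-type-036).)

Inputs, all in the tree:
* res-type-036 `JordanFour.exists_ringBrick_T_model` (p510790): the ring brick for ANY ring `C`
  identified with the even chart model `E_Q ⊆ k[x][1/Q]` (`eE`, `hbase`, ratios `t_j`);
* res-L1-w45c-stub-1 `JordanFour.exists_chartW_away_ringEquiv_twistedChart` (p512364):
  `(k[x][I₆t])_{(T′t·H′³t²)} ≃+* E_Q` with `F/1 ↦ ψ_T F` (T2(b) at `ψ := twistedChart`, engine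
  res-L1-w45c-stub-2 p506948/p510250);
* res-L1-w45c-stub-5 `JordanFour.exists_sectionsEquiv_chartW` (p514168): the seam
  `Ω : (k[x][I₆t])_{(T′t·H′³t²)} ≃+* Γ(↥O₁, (O₁.ι ≫ π ≫ q)⁻¹ ⊤)` with the base law, and
  «invariant» `↔` «fixed by every `HomogeneousLocalization.map (φ g)`»; the E-engine
  `BlowupExit.map_away_eq_of_intertwines_deg` (p510259);
* res-L1-w45c-stub-1 `JordanFour.exists_twistedChart_expo_algebraMap_and_fixed_iff` (the action of
  `⟨σ⟩` through `ψ_T` is by powers of the translation `Σ_T`), `JordanFour.smul_tPrime_mul_hPrime_cube`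
  (res-L1-w45c-stub-5, p505081).
Main results: `JordanFour.exists_ringBrick_T_of_sectionsEquiv` (model level: any `Ω`, any subring
of "invariants" characterised by the `map (φ g)`; res-L1-w45c-stub-1's
`JordanFour.exists_ringBrick_T_chartW`, p517131, is the parallel ring-side statement at `C := B_W`),
and `JordanFour.brickH1'` = the hypothesis `H₁` of p512651 verbatim (with `JordanFour.brickH0`,
res-type-087 p515853, `jordanFour_hasResolution` is one line).
-/

-- single-problem summit: the doubled namespace component `ResolutionOfSingularities` is forced
set_option linter.dupNamespace false

noncomputable section

open CategoryTheory AlgebraicGeometry TopologicalSpace MvPolynomial Polynomial HomogeneousLocalization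
open Literature.AlgebraicGeometry.Resolution Literature.AlgebraicGeometry.RelativeSpec
open scoped Pointwise

namespace Summit.ResolutionOfSingularities.ResolutionOfSingularities.Theorems.WildQuotientResolution.JordanFour

variable (k : Type) [Field k] (n : ℕ) (σ : MvPolynomial (Fin n) k ≃ₐ[k] MvPolynomial (Fin n) k)
  (a b c d : Fin n) (hab : a ≠ b) (hac : a ≠ c) (had : a ≠ d) (hbc : b ≠ c) (hbd : b ≠ d)
  (hcd : c ≠ d)
  (hb : σ (X b) = X b + X a) (hc : σ (X c) = X c + X b) (hd : σ (X d) = X d + X c)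
  (hσ : ∀ i, i ≠ b → i ≠ c → i ≠ d → σ (X i) = X i)

/-- the generator vector of `I₆` (local shorthand; unfolds at elaboration) -/
local notation3 "g8" => (![X a ^ 2, X a * X b ^ 2, X a * X b * X c, X a * X c ^ 3, X b ^ 3,
  X b ^ 2 * X c ^ 2, X b * X c ^ 4, X c ^ 6] : Fin 8 → MvPolynomial (Fin n) k)
/-- `I₆` (local shorthand) -/
local notation3 "I6" => Ideal.span (Set.range g8)
/-- `ι₀ : k[x] → Γ(Spec k[x], ⊤)` (local shorthand) -/
local notation3 "ι₀" => (Scheme.ΓSpecIso (CommRingCat.of (MvPolynomial (Fin n) k))).inv.hom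
/-- the quotient map `q : 𝔸ⁿ → 𝔸ⁿ/⟨σ⟩` (local shorthand) -/
local notation3 "qσ" => Spec.map (CommRingCat.ofHom (algebraMap
  (FixedPoints.subalgebra k (MvPolynomial (Fin n) k) (Subgroup.zpowers σ)) (MvPolynomial (Fin n) k)))
/-- the engine's `Q` (= `JordanFour.twistedQ`, `twistedQ_eq_engineQ`) -/
local notation3 "Qp" => (1 - 3 * X b * X a + X a ^ 2 * X d : MvPolynomial (Fin n) k)
/-- the engine's even generators (= `JordanFour.evenGens` as a set) -/
local notation3 "Egens" => (({X b ^ 2, X b * X a, X b * X c, X a ^ 2, X a * X c, X c ^ 2} :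
    Set (MvPolynomial (Fin n) k)) ∪
    (fun i : Fin n => (X i : MvPolynomial (Fin n) k)) '' {i | i ≠ a ∧ i ≠ b ∧ i ≠ c})
/-- `L_Q = k[x][1/Q]` -/
local notation3 "LQ" => Localization.Away Qp
/-- `E_Q ⊆ L_Q` -/
local notation3 "EQ" => Algebra.adjoin k ((algebraMap (MvPolynomial (Fin n) k) LQ) '' Egens ∪
    {(IsLocalization.Away.invSelf Qp : LQ)})
/-- the section `T′t · H′³t²` defining `chartW` -/
local notation3 "sW" => (reesT (tPrime k n a b c d) (tPrime_mem_I6 k n a b c d) * hCubeT2 k n a b c)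
/-- the chart ring `(k[x][I₆t])_{(T′t·H′³t²)}` -/
local notation3 "BW" => HomogeneousLocalization.Away (reesGrading I6) sW
/-- `F ↦ F/1 : k[x] → (k[x][I₆t])_{(T′t·H′³t²)}` -/
local notation3 (prettyPrint := false) "fz" => ((fromZeroRingHom (reesGrading I6) (.powers sW)).comp
    (reesGrading.zeroRingHom I6))

/-! ## Small inputs -/

/-- A `k`-algebra endomorphism `τ` of `k[x]` fixing `Q` extends to `k[x][1/Q]` over `τ`. [folklore] -/
theorem exists_algHom_away_over (Q : MvPolynomial (Fin n) k)
    (τ : MvPolynomial (Fin n) k →ₐ[k] MvPolynomial (Fin n) k) (hQ : τ Q = Q) :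
    ∃ τL : Localization.Away Q →ₐ[k] Localization.Away Q,
      ∀ r, τL (algebraMap (MvPolynomial (Fin n) k) (Localization.Away Q) r) =
        algebraMap (MvPolynomial (Fin n) k) (Localization.Away Q) (τ r) := by
  have hle : Submonoid.powers Q ≤ (Submonoid.powers Q).comap
      (τ : MvPolynomial (Fin n) k →+* MvPolynomial (Fin n) k) := by
    rintro _ ⟨m, rfl⟩
    refine ⟨m, ?_⟩
    rw [RingHom.coe_coe, map_pow, hQ]
  let F : Localization.Away Q →+* Localization.Away Q :=
    IsLocalization.map (Localization.Away Q) (τ : MvPolynomial (Fin n) k →+* MvPolynomial (Fin n) k)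
      hle
  have hF : ∀ r, F (algebraMap (MvPolynomial (Fin n) k) (Localization.Away Q) r) =
      algebraMap (MvPolynomial (Fin n) k) (Localization.Away Q) (τ r) := fun r =>
    IsLocalization.map_eq hle r
  refine ⟨⟨F, fun r => ?_⟩, hF⟩
  rw [IsScalarTower.algebraMap_apply k (MvPolynomial (Fin n) k) (Localization.Away Q)]
  change F _ = _
  rw [hF, AlgHom.commutes]

set_option maxHeartbeats 1000000 in
/-- `1/Q` does not depend on the spelling of `Q` (`twistedQ = Qp`). [folklore] -/
theorem invSelf_twistedQ_eq [IsLocalization.Away (twistedQ k n a b d) LQ] :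
    (IsLocalization.Away.invSelf (S := LQ) (twistedQ k n a b d)) =
      IsLocalization.Away.invSelf (S := LQ) Qp := by
  have h1 : algebraMap _ LQ Qp * IsLocalization.Away.invSelf (S := LQ) Qp = 1 :=
    IsLocalization.Away.mul_invSelf _
  have h2 : algebraMap _ LQ (twistedQ k n a b d) *
      IsLocalization.Away.invSelf (S := LQ) (twistedQ k n a b d) = 1 :=
    IsLocalization.Away.mul_invSelf _
  have h3 : algebraMap (MvPolynomial (Fin n) k) LQ (twistedQ k n a b d) = algebraMap _ LQ Qp :=
    congrArg _ (twistedQ_eq_engineQ k n a b d)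
  rw [h3] at h2
  calc IsLocalization.Away.invSelf (S := LQ) (twistedQ k n a b d)
      = IsLocalization.Away.invSelf (S := LQ) (twistedQ k n a b d) *
          (algebraMap _ LQ Qp * IsLocalization.Away.invSelf (S := LQ) Qp) := by rw [h1, mul_one]
    _ = (algebraMap _ LQ Qp * IsLocalization.Away.invSelf (S := LQ) (twistedQ k n a b d)) *
          IsLocalization.Away.invSelf (S := LQ) Qp := by ring
    _ = IsLocalization.Away.invSelf (S := LQ) Qp := by rw [h2, one_mul]

set_option maxHeartbeats 1000000 in
/-- `E_Q` in the letters of res-type-036 (`evenGens`, `1/twistedQ`). [OURS · L1 W4.5c] -/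
theorem engineE_eq_evenModel [IsLocalization.Away (twistedQ k n a b d) LQ] :
    (EQ) = Algebra.adjoin k (algebraMap (MvPolynomial (Fin n) k) LQ '' evenGens k n a b c ∪
      {IsLocalization.Away.invSelf (S := LQ) (twistedQ k n a b d)}) := by
  have hset : (Egens) = evenGens k n a b c := by
    rw [show (X b * X a : MvPolynomial (Fin n) k) = X a * X b from mul_comm _ _]
    simp only [evenGens]
    ext f
    simp only [Set.mem_union, Set.mem_insert_iff, Set.mem_singleton_iff]
    tauto
  rw [invSelf_twistedQ_eq, ← hset]

/-! ## The model-level brick: any seam `Ω`, invariants read through `map (φ g)` -/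

include hab hac had hbc hbd hcd hb hc hd hσ in
-- the statement's types (`HomogeneousLocalization.Away` of the Rees algebra, the model `E_Q`) are
-- heavy to elaborate; the proof is an assembly of landed lemmas
set_option maxHeartbeats 4000000 in
/-- **Ring brick `H₁` at the model level.** Let `Ω : (k[x][I₆t])_{(T′t·H′³t²)} ≃+* C` be any ring
identification (the seam), `Inv ⊆ C` a subring with `Ω y ∈ Inv ↔ ∀ g, map (φ g) y = y` for the
Rees-graded family `φ` with the coefficient law `g⁻¹ • ·`; let the base map factor as
`Ω(F/1) = f (g (h F))` through a multiplicative `f : A → C` (in the application: `h = ι₀`,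
`g = π^*`, `f = ` restriction to `O₁`), and `T_j ∈ A` (`j ≠ 4`) with `g(h g_j) = g(h T′) · T_j` (the
chart ratios). Then there are `R₀`, a radical `J₀ ⊆ R₀` with `Bl_{J₀} R₀` regular, and an injective
`ψ : R₀ → C` with range `Inv` and `√(ψ⁻¹⟨f g h x_a, f g h x_b, f g h x_c, f T_j⟩) = J₀`.
[OURS · L1 W4.5c] [folklore; assembly of landed decls] -/
theorem exists_ringBrick_T_of_sectionsEquiv (p : ℕ) (hp : p.Prime) (hp5 : 5 ≤ p) [CharP k p]
    [Finite (Subgroup.zpowers σ)]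
    (φ : ↥(Subgroup.zpowers σ) → (reesGrading I6 →+*ᵍ reesGrading I6))
    (hP : ∀ g, Submonoid.powers sW ≤ (Submonoid.powers sW).comap (φ g))
    (hφ : ∀ (g : ↥(Subgroup.zpowers σ)) x, ((φ g x : reesAlgebra I6) : (MvPolynomial (Fin n) k)[X]) =
      (x : (MvPolynomial (Fin n) k)[X]).map ((MulSemiringAction.toRingEquiv
        (↥(Subgroup.zpowers σ)) (MvPolynomial (Fin n) k) g⁻¹ : _ ≃+* _) : _ →+* _))
    {C : Type} [CommRing C] (Ω : BW ≃+* C) (Inv : Subring C)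
    (hΩinv : ∀ y, Ω y ∈ Inv ↔ ∀ g, HomogeneousLocalization.map (φ g) (hP g) y = y)
    {A B : Type} [Mul A] (f : A → C) (hf : ∀ x y, f (x * y) = f x * f y) (g : B → A)
    (h : MvPolynomial (Fin n) k → B) (hbase₀ : ∀ F, f (g (h F)) = Ω (fz F))
    (T : {j : Fin 8 // j ≠ 4} → A)
    (hT : ∀ j, g (h (g8 j.1)) = g (h (tPrime k n a b c d)) * T j) :
    ∃ (R₀ : Type) (_ : CommRing R₀) (J₀ : Ideal R₀) (ψ : R₀ →+* C),
      Function.Injective ψ ∧ ψ.range = Inv ∧ J₀.IsRadical ∧ Scheme.IsRegular (affineBlowup J₀) ∧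
      ((Ideal.span (f '' (g '' (h '' {X a, X b, X c}) ∪ Set.range T))).comap ψ).radical =
        J₀ := by
  classical
  have h2 : (2 : k) ≠ 0 := two_ne_zero_of_charP k p hp5
  have h3 : (3 : k) ≠ 0 := three_ne_zero_of_charP k p hp5
  -- T2(b), instance of record
  obtain ⟨e, he1, -, -⟩ :=
    exists_chartW_away_ringEquiv_twistedChart k n a b c d hab hac had hbc hbd hcd h2 h3
  -- the translation `Σ_T` and its extension to `L_Q`
  obtain ⟨τ, hτc, hτ⟩ := exists_translate k n b c
  have hQeq : twistedQ k n a b d = Qp := twistedQ_eq_engineQ k n a b d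
  have hτQ : τ Qp = Qp := by
    rw [← hQeq]; exact translate_twistedQ k n a b c d τ hτ hac hbc hcd
  have hQne : (Qp) ≠ 0 := by
    rw [← hQeq]
    exact fun h => twistedQ_not_mem_span_X_abc k n a b c d (h ▸ Ideal.zero_mem _)
  haveI : IsDomain LQ :=
    IsLocalization.isDomain_localization (powers_le_nonZeroDivisors_of_noZeroDivisors hQne)
  haveI instQ : IsLocalization.Away (twistedQ k n a b d) LQ := by rw [hQeq]; infer_instance
  have hinjL : Function.Injective (algebraMap (MvPolynomial (Fin n) k) LQ) :=
    IsLocalization.injective LQ (powers_le_nonZeroDivisors_of_noZeroDivisors hQne)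
  obtain ⟨τL, hτL⟩ := exists_algHom_away_over k n Qp τ hτQ
  -- the action of `⟨σ⟩` through `ψ_T`: powers of `τL`
  obtain ⟨m, -, hmg, hmfix⟩ := exists_twistedChart_expo_algebraMap_and_fixed_iff k n a b c d
    hab hac had hbc hbd hcd τ hτc hτ σ hb hc hd hσ h2 h3 τL hτL
  -- the data for res-type-036's model brick
  have hE := engineE_eq_evenModel k n a b c d
  set base : MvPolynomial (Fin n) k →+* C := Ω.toRingHom.comp fz with hbase_def
  set eE : C ≃+* EQ := Ω.symm.trans e with heE_def
  have hbase : ∀ F, ((eE (base F) : EQ) : LQ) =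
      algebraMap (MvPolynomial (Fin n) k) LQ (twistedChart k n a b c d F) := by
    intro F
    rw [heE_def, hbase_def, RingHom.comp_apply, RingEquiv.toRingHom_eq_coe,
      RingEquiv.coe_toRingHom, RingEquiv.trans_apply, RingEquiv.symm_apply_apply]
    exact he1 F
  have hbase₁ : ∀ F, base F = f (g (h F)) := fun F => by
    rw [hbase₀, hbase_def]; rfl
  have ht' : ∀ j, base (tPrime k n a b c d) * f (T j) = base (g8 j.1) := fun j => by
    rw [hbase₁, hbase₁, ← hf, ← hT]
  obtain ⟨R₀, _, J₀, ψC, hinj, hrange, hrad, hreg, hJ⟩ := exists_ringBrick_T_model k n a b c d p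
    hp hp5 hab hac had hbc hbd hcd τ hτc hτ τL hτL EQ hE base eE hbase (fun j => f (T j)) ht'
  -- the generating set of the curve ideal, in the two spellings
  have hset : f '' (g '' (h '' {X a, X b, X c}) ∪ Set.range T) =
      base '' {X a, X b, X c} ∪ Set.range (fun j => f (T j)) := by
    rw [Set.image_union, Set.image_image, Set.image_image, ← Set.range_comp]
    have hfun : (fun x => f (g (h x))) = base := funext fun F => (hbase₁ F).symm
    rw [hfun]
    rfl
  -- the E-engine: `e ∘ map (φ g) = τL^{m g⁻¹} ∘ e`
  set eL : BW →+* LQ := (EQ).val.toRingHom.comp e.toRingHom with heL_def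
  have heL : ∀ y, eL y = ((e y : EQ) : LQ) := fun y => rfl
  have heL1 : ∀ F, eL (fz F) = algebraMap (MvPolynomial (Fin n) k) LQ (twistedChart k n a b c d F) :=
    fun F => by rw [heL]; exact he1 F
  have hsw := coe_sectionW k n a b c d
  have hτw : ∀ g : ↥(Subgroup.zpowers σ), ((MulSemiringAction.toRingEquiv
      (↥(Subgroup.zpowers σ)) (MvPolynomial (Fin n) k) g⁻¹ : _ ≃+* _) : _ →+* _)
      (tPrime k n a b c d * hPrime k n a b c ^ 3) = tPrime k n a b c d * hPrime k n a b c ^ 3 := by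
    intro g
    rw [RingHom.coe_coe, MulSemiringAction.toRingEquiv_apply_apply]
    exact smul_tPrime_mul_hPrime_cube k n σ a b c d hab hac had hb hc hd hσ g⁻¹
  have hnzd : eL (fz (tPrime k n a b c d * hPrime k n a b c ^ 3)) ∈ nonZeroDivisors LQ := by
    refine mem_nonZeroDivisors_of_ne_zero ?_
    rw [heL1, map_mul, map_pow, twistedChart_tPrime k n a b c d hab hac had hbc hbd hcd h2 h3,
      twistedChart_hPrime k n a b c d hab hac hbc h2, map_ne_zero_iff _ hinjL, hQeq]
    have hXb : (X b : MvPolynomial (Fin n) k) ≠ 0 := X_ne_zero b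
    exact mul_ne_zero (mul_ne_zero (pow_ne_zero _ hXb) hQne)
      (pow_ne_zero _ (mul_ne_zero (pow_ne_zero _ hXb) hQne))
  have hSg : ∀ (g : ↥(Subgroup.zpowers σ)) (r : MvPolynomial (Fin n) k),
      ((τL ^ m g⁻¹ : LQ →ₐ[k] LQ) : LQ →+* LQ) (eL (fz r)) =
        eL (fz (((MulSemiringAction.toRingEquiv (↥(Subgroup.zpowers σ)) (MvPolynomial (Fin n) k)
          g⁻¹ : _ ≃+* _) : _ →+* _) r)) := by
    intro g r
    rw [heL1, heL1, RingHom.coe_coe, RingHom.coe_coe, hmg g⁻¹ r]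
  have eng : ∀ (g : ↥(Subgroup.zpowers σ)) (y : BW),
      eL (HomogeneousLocalization.map (φ g) (hP g) y) = (τL ^ m g⁻¹) (eL y) := by
    intro g y
    exact BlowupExit.map_away_eq_of_intertwines_deg sW (chartW_section_mem k n a b c d)
      (tPrime k n a b c d * hPrime k n a b c ^ 3) hsw (φ g)
      ((MulSemiringAction.toRingEquiv (↥(Subgroup.zpowers σ)) (MvPolynomial (Fin n) k) g⁻¹ :
        _ ≃+* _) : _ →+* _) (hφ g) (hτw g) (hP g) eL hnzd
      ((τL ^ m g⁻¹ : LQ →ₐ[k] LQ) : LQ →+* LQ) (hSg g) y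
  have heLinj : Function.Injective eL := fun x y hxy =>
    e.injective (Subtype.ext (by rwa [heL, heL] at hxy))
  refine ⟨R₀, inferInstance, J₀, ψC, hinj, ?_, hrad, hreg, by rw [hset]; exact hJ⟩
  -- range = invariants
  ext y
  obtain ⟨y', rfl⟩ := Ω.surjective y
  rw [hrange, hΩinv]
  have hy : ((eE (Ω y') : EQ) : LQ) = eL y' := by
    rw [heL, heE_def, RingEquiv.trans_apply, RingEquiv.symm_apply_apply]
  rw [hy, ← hmfix (eL y')]
  constructor
  · intro h g
    apply heLinj
    rw [eng]
    exact h g⁻¹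
  · intro h g
    have := congrArg eL (h g⁻¹)
    rw [eng, inv_inv] at this
    exact this

/-! ## The scheme brick `H₁` of the V4U scaffold, literally -/

include hab hac had hbc hbd hcd hb hc hd hσ in
-- the statement is long (the literal binder types of the scaffold p512651); elaboration needs
-- head-room, as for the seam (p514168) and the scaffold itself
set_option maxHeartbeats 8000000 in
/-- **Ring brick `H₁` (the `μ₂` piece).** VERBATIM the hypothesis `H₁` of
`JordanFour.jordanFour_hasResolution_of_ringBricks` (res-L1-w45c-lead-1, p512651) /
`JordanFour.coneBrick_T_of_ringBrick` (p508076): for the lifted `⟨σ⟩`-action on `Bl_{I₆} 𝔸ⁿ` and a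
stable affine open `O₁ = chartW = D₊(T′t·H′³t²)`, the ring of sections `Γ(O₁)` receives an
injective ring map `ψ` from `R₁ = (½(1,1,1)-cone ⊗ k[η, passengers])_Q` with range the invariants,
and the ideal of the fixed curve `⟨x_a, x_b, x_c, (g_j t)/(T′t)⟩` pulls back to an ideal with radical
`J₁`, `J₁` radical with `Bl_{J₁}` regular. Assembly: the seam `exists_sectionsEquiv_chartW`
(res-L1-w45c-stub-5) + `exists_ringBrick_T_of_sectionsEquiv`. [OURS · L1 W4.5c]
[folklore; assembly of landed decls] -/
theorem brickH1' (p : ℕ) (hp : p.Prime) (hp5 : 5 ≤ p) [CharP k p]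
    [Finite ↥(Subgroup.zpowers σ)]
    (ρ : ↥(Subgroup.zpowers σ) →* Aut (Spec (CommRingCat.of (MvPolynomial (Fin n) k))))
    (hρ : ∀ g : ↥(Subgroup.zpowers σ), (ρ g).hom = Spec.map (CommRingCat.ofHom
      ((MulSemiringAction.toRingEquiv (↥(Subgroup.zpowers σ)) (MvPolynomial (Fin n) k) g⁻¹ :
        MvPolynomial (Fin n) k ≃+* MvPolynomial (Fin n) k) :
          MvPolynomial (Fin n) k →+* MvPolynomial (Fin n) k)))
    (ρB : ActionOver (affineBlowup.π I6 ≫ qσ) ↥(Subgroup.zpowers σ))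
    (haut : ρB.aut = (affineBlowup.isBlowup I6).liftAction ρ
      (idealSheaf_I6_comap k n σ a b c (hσ a hab hac had) hb hc ρ hρ))
    (O₁ : ρB.StableAffineOpens) (hO₁ : O₁.1 = chartW k n a b c d)
    (hle : ((O₁.1.ι ≫ affineBlowup.π I6 ≫ qσ) ⁻¹ᵁ ⊤ : (O₁.1 : Scheme.{0}).Opens) ≤
      O₁.1.ι ⁻¹ᵁ blowupChart (affineBlowup.π I6) (affineBlowup.idealSheaf I6)
        ⟨⊤, isAffineOpen_top _⟩ (ι₀ (tPrime k n a b c d)))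
    (T : {j : Fin 8 // j ≠ 4} → Γ(affineBlowup I6,
      blowupChart (affineBlowup.π I6) (affineBlowup.idealSheaf I6) ⟨⊤, isAffineOpen_top _⟩
        (ι₀ (tPrime k n a b c d))))
    (hT : ∀ j, (affineBlowup.π I6).appLE ⊤
        (blowupChart (affineBlowup.π I6) (affineBlowup.idealSheaf I6) ⟨⊤, isAffineOpen_top _⟩
          (ι₀ (tPrime k n a b c d)))
        (blowupChart_le_preimage (affineBlowup.π I6) (affineBlowup.idealSheaf I6)
          ⟨⊤, isAffineOpen_top _⟩ (ι₀ (tPrime k n a b c d)))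
        (ι₀ (g8 j.1)) =
      (affineBlowup.π I6).appLE ⊤
        (blowupChart (affineBlowup.π I6) (affineBlowup.idealSheaf I6) ⟨⊤, isAffineOpen_top _⟩
          (ι₀ (tPrime k n a b c d)))
        (blowupChart_le_preimage (affineBlowup.π I6) (affineBlowup.idealSheaf I6)
          ⟨⊤, isAffineOpen_top _⟩ (ι₀ (tPrime k n a b c d)))
        (ι₀ (tPrime k n a b c d)) * T j) :
    ∃ (R₁ : Type) (_ : CommRing R₁) (J₁ : Ideal R₁)
      (ψ : R₁ →+* Γ((O₁.1 : Scheme.{0}), (O₁.1.ι ≫ affineBlowup.π I6 ≫ qσ) ⁻¹ᵁ ⊤)),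
      Function.Injective ψ ∧ ψ.range = (ρB.restrict O₁.1 O₁.2.1).invariantsRing ⊤ ∧
      J₁.IsRadical ∧ Scheme.IsRegular (affineBlowup J₁) ∧
      ((Ideal.span ((O₁.1.ι.appLE
          (blowupChart (affineBlowup.π I6) (affineBlowup.idealSheaf I6) ⟨⊤, isAffineOpen_top _⟩
            (ι₀ (tPrime k n a b c d)))
          ((O₁.1.ι ≫ affineBlowup.π I6 ≫ qσ) ⁻¹ᵁ ⊤) hle) ''
        (((affineBlowup.π I6).appLE ⊤
            (blowupChart (affineBlowup.π I6) (affineBlowup.idealSheaf I6) ⟨⊤, isAffineOpen_top _⟩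
              (ι₀ (tPrime k n a b c d)))
            (blowupChart_le_preimage (affineBlowup.π I6) (affineBlowup.idealSheaf I6)
              ⟨⊤, isAffineOpen_top _⟩ (ι₀ (tPrime k n a b c d)))) ''
          ((Scheme.ΓSpecIso (CommRingCat.of (MvPolynomial (Fin n) k))).inv '' {X a, X b, X c}) ∪
          Set.range T))).comap ψ).radical = J₁ := by
  have H := exists_sectionsEquiv_chartW k n σ a b c d hab hac had hb hc hd hσ ρ hρ ρB haut O₁ hO₁
    hle
  rcases H with ⟨φ, hP, Ω, hφ, hΩbase, -, hΩinv⟩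
  exact exists_ringBrick_T_of_sectionsEquiv k n σ a b c d hab hac had hbc hbd hcd hb hc hd hσ
    p hp hp5 φ hP hφ Ω ((ρB.restrict O₁.1 O₁.2.1).invariantsRing ⊤) hΩinv _ (fun x y => map_mul _ x y)
    _ _ hΩbase T hT

end Summit.ResolutionOfSingularities.ResolutionOfSingularities.Theorems.WildQuotientResolution.JordanFour

end
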